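import Mathlib
import HarnessLib
import Summits.HubbardSuperconductivity.HubbardSuperconductivity.Theorems.KLProgrammeKLRegimeVolumeLimitCauchy

/-!
# Route `KLProgramme` — crux K3, child «VolumeLimit» (gen 3 stmt-…-19826 / gen 4 `VolumeLimitP2 klPredsV12 FinalTwoLegVolLimitEx klWindowC`):
# TERMWISE two-volume rates, summed — the engine-facing half of the Cauchy route (`…VolumeLimitCauchy`, p475992)
# (cell gate-hubbard-kl, seat hubbard-kl-k3c4-p1 g3, technique «volume lemmas»)

WHY.  Plan g11's VL ruling (HOME/STATUS 2026-08-26T23:34:46Z (2)) types the engine lane's export duty for the volume-limit child as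
«uniform bound + TWO-VOLUME RATE WITH CROSS-GRID MODULUS for `klSelfEnergy … (nScales β + 1)`», proved as theorems about the carrier —
the stub `stub_vl_twoVolumeRate` of the Cauchy skeleton.  What a convergent single-scale expansion produces is TERMWISE: beyond thresholds
`Σ̂_{L,M}(k,σ) = Σ_t v_t(L,M;k,σ)` with `L`-uniform summable majorants `‖v_t‖ ≤ m_t`, and for each term — a Riemann sum over the torus
momentum grid of an `L`-independent integrand — a two-volume rate `‖v_t(L,M;(ω,k),σ) − v_t(L′,M′;(ω′,k′),σ)‖ ≤ ρ_t L + D_t·Σ_i|p_k i − p′_{k′} i|_𝕋`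
(`Literature/…/BrillouinRiemannSumRate`: `2πK_t/L + 2πK_t/L′` plus the integrand's modulus in the external momentum).  This module sums
them: NO limit objects, no continuity proofs term by term — the companion of `…VolumeLimitTannery.volLimit_of_termwise` with termwise
LIMITS replaced by termwise RATES.

* `klvct_norm_le_min_add` — the elementary step `‖d‖ ≤ ρ + Dx`, `‖d‖ ≤ 2m` ⇒ `‖d‖ ≤ min ρ (2m) + Dx`;
* `twoVolumeRate_of_termwise` — ABSTRACT form: termwise representation + majorants `m` (summable) + termwise rates `(ρ_t, D_t)` with
  `ρ_t → 0`, `ρ_t ≥ 0`, `D` summable and nonnegative ⇒ the sum obeys (a) `‖S‖ ≤ Σ' m` and (b) the two-volume rate with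
  `ρ̄ L := Σ'_t min (ρ_t L) (2 m_t) → 0` (Tannery: dominated by `2 m_t`) and `D̄ := Σ' D`;
* `finalTwoLegVolLimit_of_termwiseRates` / `exists_finalTwoLegVolLimit_of_termwiseRates` — the instance `S = klSelfEnergy … (nScales β + 1)`:
  **termwise two-volume rates under summable majorants ⇒ `FinalTwoLegVolLimit β U μ K Mth`** (via `finalTwoLegVolLimit_of_twoVolumeRate`).

Pure bookkeeping (`tendsto_tsum_of_dominated_convergence`, `HasSum.norm_le_of_bounded`); nothing is asserted about the model.  References:
G. Benfatto, A. Giuliani, V. Mastropietro, Ann. Henri Poincaré 7 (2006) 809–898, §2.3 fn. 1, §2.4; Friedli–Velenik (2017) §10.5.2.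
-/

noncomputable section

namespace Summit.HubbardSuperconductivity.HubbardSuperconductivity.Theorems.KLRegimeSplit

set_option linter.dupNamespace false -- summit = problem name (single-conjunct summit), D-0017

open Filter Topology Finset Literature.MathematicalPhysics.QuantumLattice Literature.Probability.LatticeModels
open Summit.HubbardSuperconductivity.HubbardSuperconductivity.Theorems.KLProgrammeLegKernels

/-- The elementary step: `‖d‖ ≤ ρ + D·x` and `‖d‖ ≤ 2m` with `0 ≤ D·x` give `‖d‖ ≤ min ρ (2m) + D·x`. [folklore] -/
theorem klvct_norm_le_min_add {E : Type*} [SeminormedAddCommGroup E] {d : E} {ρ m Dx : ℝ} (hDx : 0 ≤ Dx)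
    (h₁ : ‖d‖ ≤ ρ + Dx) (h₂ : ‖d‖ ≤ 2 * m) : ‖d‖ ≤ min ρ (2 * m) + Dx := by
  rcases le_total ρ (2 * m) with h | h
  · rw [min_eq_left h]; exact h₁
  · rw [min_eq_right h]; linarith

/-- **Termwise two-volume rates, summed** (abstract form).  Let `S L M : FreqMomentum L M → Fin 2 → ℂ` have, beyond thresholds
`(L₀, Mth)`, a termwise representation `S = Σ_t v_t` (`HasSum`) with `L`-uniform summable nonnegative majorants `‖v_t‖ ≤ m_t`, and let every
term obey a two-volume rate with cross-grid modulus, `‖v_t(L,M;(ω,k),σ) − v_t(L′,M′;(ω′,k′),σ)‖ ≤ ρ_t L + D_t·Σ_i|p_k i − p′_{k′} i|_𝕋`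
(`L₀ ≤ L ≤ L′`, `Mth L ≤ M`, `Mth L′ ≤ M′`, equal Matsubara integers), with `ρ_t ≥ 0`, `ρ_t → 0` for each `t`, and `D ≥ 0` summable.  Then
the sum obeys the uniform bound `Σ' m` and the two-volume rate with `ρ̄ L = Σ'_t min (ρ_t L) (2 m_t)` — which tends to `0` — and
`D̄ = Σ' D`. [folklore] -/
theorem twoVolumeRate_of_termwise
    {S : ∀ (L M : ℕ) [NeZero L] [NeZero M], FreqMomentum L M → Fin 2 → ℂ} {Mth : ℕ → ℕ} {L₀ : ℕ} {ι : Type*}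
    {v : ι → ∀ (L M : ℕ) [NeZero L] [NeZero M], FreqMomentum L M → Fin 2 → ℂ}
    {m D : ι → ℝ} {ρ : ι → ℕ → ℝ} (hm : Summable m) (hm0 : ∀ t, 0 ≤ m t) (hD : Summable D) (hD0 : ∀ t, 0 ≤ D t)
    (hρ : ∀ t, Tendsto (ρ t) atTop (𝓝 0)) (hρ0 : ∀ t L, 0 ≤ ρ t L)
    (hrepr : ∀ (L : ℕ) [NeZero L], L₀ ≤ L → ∀ (M : ℕ) [NeZero M], Mth L ≤ M →
      ∀ (k : FreqMomentum L M) (σ : Fin 2), HasSum (fun t => v t L M k σ) (S L M k σ))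
    (hmaj : ∀ (t : ι) (L : ℕ) [NeZero L], L₀ ≤ L → ∀ (M : ℕ) [NeZero M], Mth L ≤ M →
      ∀ (k : FreqMomentum L M) (σ : Fin 2), ‖v t L M k σ‖ ≤ m t)
    (hrate : ∀ (t : ι) (L : ℕ) [NeZero L], L₀ ≤ L → ∀ (M : ℕ) [NeZero M], Mth L ≤ M →
      ∀ (L' : ℕ) [NeZero L'], L ≤ L' → ∀ (M' : ℕ) [NeZero M'], Mth L' ≤ M' →
        ∀ (σ : Fin 2) (ω : MatsubaraIdx M) (ω' : MatsubaraIdx M'), matsubaraInt M ω = matsubaraInt M' ω' →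
          ∀ (k : TorusSite 2 L) (k' : TorusSite 2 L'),
            ‖v t L M (ω, k) σ - v t L' M' (ω', k') σ‖ ≤
              ρ t L + D t * ∑ i, torusAbs (latticeMomentum L k i - latticeMomentum L' k' i)) :
    Tendsto (fun L : ℕ => ∑' t, min (ρ t L) (2 * m t)) atTop (𝓝 0) ∧
    (∀ (L : ℕ) [NeZero L], L₀ ≤ L → ∀ (M : ℕ) [NeZero M], Mth L ≤ M →
      ∀ (k : FreqMomentum L M) (σ : Fin 2), ‖S L M k σ‖ ≤ ∑' t, m t) ∧
    (∀ (L : ℕ) [NeZero L], L₀ ≤ L → ∀ (M : ℕ) [NeZero M], Mth L ≤ M →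
      ∀ (L' : ℕ) [NeZero L'], L ≤ L' → ∀ (M' : ℕ) [NeZero M'], Mth L' ≤ M' →
        ∀ (σ : Fin 2) (ω : MatsubaraIdx M) (ω' : MatsubaraIdx M'), matsubaraInt M ω = matsubaraInt M' ω' →
          ∀ (k : TorusSite 2 L) (k' : TorusSite 2 L'),
            ‖S L M (ω, k) σ - S L' M' (ω', k') σ‖ ≤
              (∑' t, min (ρ t L) (2 * m t)) + (∑' t, D t) * ∑ i, torusAbs (latticeMomentum L k i - latticeMomentum L' k' i)) := by
  classical
  -- the combined rate is dominated by `2 m_t`, termwise `→ 0`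
  have hmin_nn : ∀ t L, 0 ≤ min (ρ t L) (2 * m t) := fun t L => le_min (hρ0 t L) (by linarith [hm0 t])
  have hmin_le : ∀ t L, min (ρ t L) (2 * m t) ≤ 2 * m t := fun t L => min_le_right _ _
  have hmin_summ : ∀ L, Summable fun t => min (ρ t L) (2 * m t) := fun L =>
    (hm.mul_left 2).of_nonneg_of_le (fun t => hmin_nn t L) (fun t => hmin_le t L)
  refine ⟨?_, ?_, ?_⟩
  · -- Tannery
    have hlim : ∀ t, Tendsto (fun L : ℕ => min (ρ t L) (2 * m t)) atTop (𝓝 0) := by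
      intro t
      have h := (hρ t).min (tendsto_const_nhds (x := 2 * m t))
      rwa [min_eq_left (by linarith [hm0 t] : (0 : ℝ) ≤ 2 * m t)] at h
    have h := tendsto_tsum_of_dominated_convergence (𝓕 := atTop) (f := fun (L : ℕ) (t : ι) => min (ρ t L) (2 * m t))
      (g := fun _ => (0 : ℝ)) (bound := fun t => 2 * m t) (hm.mul_left 2) hlim
      (Eventually.of_forall fun L t => by
        rw [Real.norm_eq_abs, abs_of_nonneg (hmin_nn t L)]; exact hmin_le t L)
    simpa using h
  · intro L _ hL M _ hM k σ
    exact (hrepr L hL M hM k σ).norm_le_of_bounded hm.hasSum fun t => hmaj t L hL M hM k σ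
  · intro L _ hL M _ hM L' _ hLL' M' _ hM' σ ω ω' hωω' k k'
    set x : ℝ := ∑ i, torusAbs (latticeMomentum L k i - latticeMomentum L' k' i) with hx
    have hx0 : 0 ≤ x := Finset.sum_nonneg fun i _ => klvc_torusAbs_nonneg _
    have hL' : L₀ ≤ L' := hL.trans hLL'
    -- the difference series and its majorant
    have hd : HasSum (fun t => v t L M (ω, k) σ - v t L' M' (ω', k') σ) (S L M (ω, k) σ - S L' M' (ω', k') σ) :=
      (hrepr L hL M hM (ω, k) σ).sub (hrepr L' hL' M' hM' (ω', k') σ)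
    have hg : HasSum (fun t => min (ρ t L) (2 * m t) + D t * x) ((∑' t, min (ρ t L) (2 * m t)) + (∑' t, D t) * x) :=
      (hmin_summ L).hasSum.add (hD.hasSum.mul_right x)
    refine hd.norm_le_of_bounded hg fun t => ?_
    refine klvct_norm_le_min_add (mul_nonneg (hD0 t) hx0) (hrate t L hL M hM L' hLL' M' hM' σ ω ω' hωω' k k') ?_
    calc ‖v t L M (ω, k) σ - v t L' M' (ω', k') σ‖
        ≤ ‖v t L M (ω, k) σ‖ + ‖v t L' M' (ω', k') σ‖ := norm_sub_le _ _
      _ ≤ m t + m t := add_le_add (hmaj t L hL M hM (ω, k) σ) (hmaj t L' hL' M' hM' (ω', k') σ)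
      _ = 2 * m t := by ring

/-- **Termwise two-volume rates ⇒ the volume-limit slot.**  If, beyond thresholds `(L₀, Mth)`, the two-leg vertex function of the fully
integrated countertermed action `klSelfEnergy L M β U μ K klE0 (nScales β + 1)` is the sum of a family `v_t` with `L`-uniform summable
majorants `m_t ≥ 0`, each term obeying a two-volume rate with cross-grid modulus `ρ_t L + D_t·Σ_i|p_k i − p′_{k′} i|_𝕋` (`ρ_t ≥ 0`,
`ρ_t → 0`; `D ≥ 0` summable), then `FinalTwoLegVolLimit β U μ K Mth` — the grid values converge, per Matsubara integer and uniformly on the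
grid, to a momentum-continuous limit, with the uniform bound `Σ' m`. [folklore] -/
theorem finalTwoLegVolLimit_of_termwiseRates {β U μ : ℝ} {K : TrigPolyC4v} {Mth : ℕ → ℕ} {L₀ : ℕ} {ι : Type*}
    {v : ι → ∀ (L M : ℕ) [NeZero L] [NeZero M], FreqMomentum L M → Fin 2 → ℂ}
    {m D : ι → ℝ} {ρ : ι → ℕ → ℝ} (hm : Summable m) (hm0 : ∀ t, 0 ≤ m t) (hD : Summable D) (hD0 : ∀ t, 0 ≤ D t)
    (hρ : ∀ t, Tendsto (ρ t) atTop (𝓝 0)) (hρ0 : ∀ t L, 0 ≤ ρ t L)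
    (hrepr : ∀ (L : ℕ) [NeZero L], L₀ ≤ L → ∀ (M : ℕ) [NeZero M], Mth L ≤ M →
      ∀ (k : FreqMomentum L M) (σ : Fin 2),
        HasSum (fun t => v t L M k σ) (klSelfEnergy L M β U μ K klE0 (nScales β + 1) k σ))
    (hmaj : ∀ (t : ι) (L : ℕ) [NeZero L], L₀ ≤ L → ∀ (M : ℕ) [NeZero M], Mth L ≤ M →
      ∀ (k : FreqMomentum L M) (σ : Fin 2), ‖v t L M k σ‖ ≤ m t)
    (hrate : ∀ (t : ι) (L : ℕ) [NeZero L], L₀ ≤ L → ∀ (M : ℕ) [NeZero M], Mth L ≤ M →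
      ∀ (L' : ℕ) [NeZero L'], L ≤ L' → ∀ (M' : ℕ) [NeZero M'], Mth L' ≤ M' →
        ∀ (σ : Fin 2) (ω : MatsubaraIdx M) (ω' : MatsubaraIdx M'), matsubaraInt M ω = matsubaraInt M' ω' →
          ∀ (k : TorusSite 2 L) (k' : TorusSite 2 L'),
            ‖v t L M (ω, k) σ - v t L' M' (ω', k') σ‖ ≤
              ρ t L + D t * ∑ i, torusAbs (latticeMomentum L k i - latticeMomentum L' k' i)) :
    FinalTwoLegVolLimit β U μ K Mth := by
  obtain ⟨hρbar, hB, hR⟩ := twoVolumeRate_of_termwise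
    (S := fun L M _ _ k σ => klSelfEnergy L M β U μ K klE0 (nScales β + 1) k σ) hm hm0 hD hD0 hρ hρ0 hrepr hmaj hrate
  exact finalTwoLegVolLimit_of_twoVolumeRate hρbar hB hR

/-- The `∃ M'` form of `finalTwoLegVolLimit_of_termwiseRates` (the shape of the ∃-threshold slot `FinalTwoLegVolLimitEx`). [folklore] -/
theorem exists_finalTwoLegVolLimit_of_termwiseRates {β U μ : ℝ} {K : TrigPolyC4v} {Mth : ℕ → ℕ} {L₀ : ℕ} {ι : Type*}
    {v : ι → ∀ (L M : ℕ) [NeZero L] [NeZero M], FreqMomentum L M → Fin 2 → ℂ}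
    {m D : ι → ℝ} {ρ : ι → ℕ → ℝ} (hm : Summable m) (hm0 : ∀ t, 0 ≤ m t) (hD : Summable D) (hD0 : ∀ t, 0 ≤ D t)
    (hρ : ∀ t, Tendsto (ρ t) atTop (𝓝 0)) (hρ0 : ∀ t L, 0 ≤ ρ t L)
    (hrepr : ∀ (L : ℕ) [NeZero L], L₀ ≤ L → ∀ (M : ℕ) [NeZero M], Mth L ≤ M →
      ∀ (k : FreqMomentum L M) (σ : Fin 2),
        HasSum (fun t => v t L M k σ) (klSelfEnergy L M β U μ K klE0 (nScales β + 1) k σ))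
    (hmaj : ∀ (t : ι) (L : ℕ) [NeZero L], L₀ ≤ L → ∀ (M : ℕ) [NeZero M], Mth L ≤ M →
      ∀ (k : FreqMomentum L M) (σ : Fin 2), ‖v t L M k σ‖ ≤ m t)
    (hrate : ∀ (t : ι) (L : ℕ) [NeZero L], L₀ ≤ L → ∀ (M : ℕ) [NeZero M], Mth L ≤ M →
      ∀ (L' : ℕ) [NeZero L'], L ≤ L' → ∀ (M' : ℕ) [NeZero M'], Mth L' ≤ M' →
        ∀ (σ : Fin 2) (ω : MatsubaraIdx M) (ω' : MatsubaraIdx M'), matsubaraInt M ω = matsubaraInt M' ω' →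
          ∀ (k : TorusSite 2 L) (k' : TorusSite 2 L'),
            ‖v t L M (ω, k) σ - v t L' M' (ω', k') σ‖ ≤
              ρ t L + D t * ∑ i, torusAbs (latticeMomentum L k i - latticeMomentum L' k' i)) :
    ∃ M' : ℕ → ℕ, FinalTwoLegVolLimit β U μ K M' :=
  ⟨Mth, finalTwoLegVolLimit_of_termwiseRates hm hm0 hD hD0 hρ hρ0 hrepr hmaj hrate⟩

/-! ## Torus-Lipschitz moduli of periodic functions (appended) — the `D_t` input of the termwise rates

The cross-grid modulus of `stub_vl_twoVolumeRate` / `twoVolumeRate_of_termwise` is `Σ_i |p_i − q_i|_𝕋`.  A `2π`-periodic function that is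
Lipschitz for the sup metric of `Fin d → ℝ` is Lipschitz for this torus modulus with the SAME constant: shift `q` by the lattice vector
`2πm` realising the torus distances coordinatewise (`klvc_exists_int_mul_abs_eq_torusAbs`), then `‖p − (q + 2πm)‖_∞ = max_i |p_i − q_i|_𝕋`.
This is how the integrands of the expansion's Riemann sums (trigonometric polynomials of the frame, propagator symbols) feed the `δ` of
`Literature/…/BrillouinRiemannSumTwoVolume.norm_momentumAverage_sub_momentumAverage_le`. -/

/-- Every real is within `|x|_𝕋` of `2πℤ`: `∃ m : ℤ, |x − 2πm| = |x|_𝕋` (`m = toIocDiv`). [folklore] -/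
theorem klvc_exists_int_mul_abs_eq_torusAbs (x : ℝ) : ∃ m : ℤ, |x - m * (2 * Real.pi)| = torusAbs x := by
  refine ⟨toIocDiv Real.two_pi_pos (-Real.pi) x, ?_⟩
  have h := toIocMod_add_toIocDiv_zsmul Real.two_pi_pos (-Real.pi) x
  rw [zsmul_eq_mul] at h
  unfold torusAbs
  congr 1
  linarith

/-- **Periodic + Lipschitz (sup metric) ⇒ Lipschitz for the torus modulus, same constant.**  For `f : (Fin d → ℝ) → E` invariant under
`p ↦ p + 2πm` (`m ∈ ℤ^d`) with `‖f p − f q‖ ≤ K‖p − q‖` for all `p q`:  `‖f p − f q‖ ≤ K · Σ_i |p_i − q_i|_𝕋`. [folklore] -/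
theorem norm_sub_le_mul_tmod_of_periodic {d : ℕ} {E : Type*} [SeminormedAddCommGroup E] {f : (Fin d → ℝ) → E} {K : ℝ} (hK : 0 ≤ K)
    (hper : ∀ (p : Fin d → ℝ) (m : Fin d → ℤ), f (fun i => p i + m i * (2 * Real.pi)) = f p)
    (hlip : ∀ p q : Fin d → ℝ, ‖f p - f q‖ ≤ K * ‖p - q‖) (p q : Fin d → ℝ) :
    ‖f p - f q‖ ≤ K * ∑ i, torusAbs (p i - q i) := by
  classical
  choose m hm using fun i => klvc_exists_int_mul_abs_eq_torusAbs (p i - q i)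
  -- shift `q` by the lattice vector `2πm`
  set q' : Fin d → ℝ := fun i => q i + m i * (2 * Real.pi) with hq'
  have hfq : f q' = f q := hper q m
  have hcoord : ∀ i, |p i - q' i| = torusAbs (p i - q i) := fun i => by
    rw [← hm i]; congr 1; simp only [hq']; ring
  have hnorm : ‖p - q'‖ ≤ ∑ i, torusAbs (p i - q i) := by
    refine (pi_norm_le_iff_of_nonneg (Finset.sum_nonneg fun i _ => klvc_torusAbs_nonneg _)).2 fun i => ?_
    rw [Pi.sub_apply, Real.norm_eq_abs, hcoord i]
    exact Finset.single_le_sum (f := fun j => torusAbs (p j - q j)) (fun j _ => klvc_torusAbs_nonneg _) (Finset.mem_univ i)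
  calc ‖f p - f q‖ = ‖f p - f q'‖ := by rw [hfq]
    _ ≤ K * ‖p - q'‖ := hlip p q'
    _ ≤ K * ∑ i, torusAbs (p i - q i) := mul_le_mul_of_nonneg_left hnorm hK

/-- The same for a scalar function composed with a Lipschitz outer map (propagator symbols `h ∘ e` with `h(x) = (x − iω)⁻¹`, …):
`‖h (e p) − h (e q)‖ ≤ K_h · K_e · Σ_i |p_i − q_i|_𝕋`. [folklore] -/
theorem norm_comp_sub_le_mul_tmod_of_periodic {d : ℕ} {E : Type*} [SeminormedAddCommGroup E] {e : (Fin d → ℝ) → ℝ} {h : ℝ → E}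
    {Ke Kh : ℝ} (hKe : 0 ≤ Ke) (hKh : 0 ≤ Kh)
    (hper : ∀ (p : Fin d → ℝ) (m : Fin d → ℤ), e (fun i => p i + m i * (2 * Real.pi)) = e p)
    (hlip : ∀ p q : Fin d → ℝ, ‖e p - e q‖ ≤ Ke * ‖p - q‖) (hh : ∀ x y : ℝ, ‖h x - h y‖ ≤ Kh * ‖x - y‖) (p q : Fin d → ℝ) :
    ‖h (e p) - h (e q)‖ ≤ Kh * Ke * ∑ i, torusAbs (p i - q i) := by
  have he := norm_sub_le_mul_tmod_of_periodic hKe hper hlip p q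
  calc ‖h (e p) - h (e q)‖ ≤ Kh * ‖e p - e q‖ := hh _ _
    _ ≤ Kh * (Ke * ∑ i, torusAbs (p i - q i)) := mul_le_mul_of_nonneg_left he hKh
    _ = Kh * Ke * ∑ i, torusAbs (p i - q i) := by ring

/-! ## Algebra of two-volume rates (appended) — grid-exact families, sums, dressings

The rate-grammar twins of `…VolumeLimitAlgebra`'s `volLimitShape_of_gridExact / _add / _dressing_mul` (k3c5-p2): how the rungs and
dressed pieces of the carrier inherit the hypothesis (b) of `volLimit_of_twoVolumeRate`.  A GRID-EXACT family `S L M (ω,k) σ = φ n p_k σ`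
read from a `2πℤ²`-periodic, sup-Lipschitz `φ n · σ` has rate `(ρ, D) = (0, K_φ)`; sums add the data; a grid-exact bounded dressing
`Φ` multiplies them as `(Bφ·ρ, Bφ·D + B·Kφ)`. -/

/-- **Grid-exact families** have two-volume rate `0` and modulus their sup-Lipschitz constant: if beyond `(L₀, Mth)`
`S L M (ω,k) σ = φ (matsubaraInt M ω) (p_k) σ` with `φ n · σ` invariant under `2πℤ²` and `‖φ n p σ − φ n q σ‖ ≤ Kφ‖p − q‖`, then
`‖S L M (ω,k) σ − S L′ M′ (ω′,k′) σ‖ ≤ 0 + Kφ·Σ_i |p_k i − p′_{k′} i|_𝕋` at equal Matsubara integers. [folklore] -/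
theorem twoVolumeRate_of_gridExact
    {S : ∀ (L M : ℕ) [NeZero L] [NeZero M], FreqMomentum L M → Fin 2 → ℂ} {Mth : ℕ → ℕ} {L₀ : ℕ}
    {φ : ℤ → (Fin 2 → ℝ) → Fin 2 → ℂ} {Kφ : ℝ} (hKφ : 0 ≤ Kφ)
    (hper : ∀ (n : ℤ) (σ : Fin 2) (p : Fin 2 → ℝ) (m : Fin 2 → ℤ), φ n (fun i => p i + m i * (2 * Real.pi)) σ = φ n p σ)
    (hlip : ∀ (n : ℤ) (σ : Fin 2) (p q : Fin 2 → ℝ), ‖φ n p σ - φ n q σ‖ ≤ Kφ * ‖p - q‖)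
    (hS : ∀ (L : ℕ) [NeZero L], L₀ ≤ L → ∀ (M : ℕ) [NeZero M], Mth L ≤ M → ∀ (ω : MatsubaraIdx M) (k : TorusSite 2 L) (σ : Fin 2),
      S L M (ω, k) σ = φ (matsubaraInt M ω) (latticeMomentum L k) σ) :
    ∀ (L : ℕ) [NeZero L], L₀ ≤ L → ∀ (M : ℕ) [NeZero M], Mth L ≤ M →
      ∀ (L' : ℕ) [NeZero L'], L ≤ L' → ∀ (M' : ℕ) [NeZero M'], Mth L' ≤ M' →
        ∀ (σ : Fin 2) (ω : MatsubaraIdx M) (ω' : MatsubaraIdx M'), matsubaraInt M ω = matsubaraInt M' ω' →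
          ∀ (k : TorusSite 2 L) (k' : TorusSite 2 L'),
            ‖S L M (ω, k) σ - S L' M' (ω', k') σ‖ ≤
              (fun _ : ℕ => (0 : ℝ)) L + Kφ * ∑ i, torusAbs (latticeMomentum L k i - latticeMomentum L' k' i) := by
  intro L _ hL M _ hM L' _ hLL' M' _ hM' σ ω ω' hωω' k k'
  rw [hS L hL M hM ω k σ, hS L' (hL.trans hLL') M' hM' ω' k' σ, ← hωω', zero_add]
  exact norm_sub_le_mul_tmod_of_periodic (f := fun p => φ (matsubaraInt M ω) p σ) hKφ
    (fun p m => hper _ σ p m) (fun p q => hlip _ σ p q) _ _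

/-- **Sum rule for two-volume rates**: rates `(ρ₁, D₁)` for `S` and `(ρ₂, D₂)` for `T` beyond common thresholds give `(ρ₁ + ρ₂, D₁ + D₂)`
for `S + T`. [folklore] -/
theorem twoVolumeRate_add
    {S T : ∀ (L M : ℕ) [NeZero L] [NeZero M], FreqMomentum L M → Fin 2 → ℂ} {Mth : ℕ → ℕ} {L₀ : ℕ} {D₁ D₂ : ℝ} {ρ₁ ρ₂ : ℕ → ℝ}
    (hS : ∀ (L : ℕ) [NeZero L], L₀ ≤ L → ∀ (M : ℕ) [NeZero M], Mth L ≤ M →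
      ∀ (L' : ℕ) [NeZero L'], L ≤ L' → ∀ (M' : ℕ) [NeZero M'], Mth L' ≤ M' →
        ∀ (σ : Fin 2) (ω : MatsubaraIdx M) (ω' : MatsubaraIdx M'), matsubaraInt M ω = matsubaraInt M' ω' →
          ∀ (k : TorusSite 2 L) (k' : TorusSite 2 L'),
            ‖S L M (ω, k) σ - S L' M' (ω', k') σ‖ ≤ ρ₁ L + D₁ * ∑ i, torusAbs (latticeMomentum L k i - latticeMomentum L' k' i))
    (hT : ∀ (L : ℕ) [NeZero L], L₀ ≤ L → ∀ (M : ℕ) [NeZero M], Mth L ≤ M →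
      ∀ (L' : ℕ) [NeZero L'], L ≤ L' → ∀ (M' : ℕ) [NeZero M'], Mth L' ≤ M' →
        ∀ (σ : Fin 2) (ω : MatsubaraIdx M) (ω' : MatsubaraIdx M'), matsubaraInt M ω = matsubaraInt M' ω' →
          ∀ (k : TorusSite 2 L) (k' : TorusSite 2 L'),
            ‖T L M (ω, k) σ - T L' M' (ω', k') σ‖ ≤ ρ₂ L + D₂ * ∑ i, torusAbs (latticeMomentum L k i - latticeMomentum L' k' i)) :
    ∀ (L : ℕ) [NeZero L], L₀ ≤ L → ∀ (M : ℕ) [NeZero M], Mth L ≤ M →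
      ∀ (L' : ℕ) [NeZero L'], L ≤ L' → ∀ (M' : ℕ) [NeZero M'], Mth L' ≤ M' →
        ∀ (σ : Fin 2) (ω : MatsubaraIdx M) (ω' : MatsubaraIdx M'), matsubaraInt M ω = matsubaraInt M' ω' →
          ∀ (k : TorusSite 2 L) (k' : TorusSite 2 L'),
            ‖(S L M (ω, k) σ + T L M (ω, k) σ) - (S L' M' (ω', k') σ + T L' M' (ω', k') σ)‖ ≤
              (fun L => ρ₁ L + ρ₂ L) L + (D₁ + D₂) * ∑ i, torusAbs (latticeMomentum L k i - latticeMomentum L' k' i) := by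
  intro L _ hL M _ hM L' _ hLL' M' _ hM' σ ω ω' hωω' k k'
  have h₁ := hS L hL M hM L' hLL' M' hM' σ ω ω' hωω' k k'
  have h₂ := hT L hL M hM L' hLL' M' hM' σ ω ω' hωω' k k'
  calc ‖(S L M (ω, k) σ + T L M (ω, k) σ) - (S L' M' (ω', k') σ + T L' M' (ω', k') σ)‖
      = ‖(S L M (ω, k) σ - S L' M' (ω', k') σ) + (T L M (ω, k) σ - T L' M' (ω', k') σ)‖ := by congr 1; abel
    _ ≤ ‖S L M (ω, k) σ - S L' M' (ω', k') σ‖ + ‖T L M (ω, k) σ - T L' M' (ω', k') σ‖ := norm_add_le _ _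
    _ ≤ _ := by simp only; linarith [h₁, h₂]

/-- **Dressing rule for two-volume rates**: `S` with rate `(ρ, D)` and uniform bound `B` beyond `(L₀, Mth)`, multiplied by a grid-exact
dressing `Φ L M (ω,k) = φ (matsubaraInt M ω) (p_k)` with `φ n` invariant under `2πℤ²`, `‖φ n p‖ ≤ Bφ` and `‖φ n p − φ n q‖ ≤ Kφ‖p − q‖`,
has rate `(Bφ·ρ, Bφ·D + B·Kφ)` (`ΦS − Φ′S′ = Φ(S − S′) + (Φ − Φ′)S′`). [folklore] -/
theorem twoVolumeRate_dressing_mul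
    {S : ∀ (L M : ℕ) [NeZero L] [NeZero M], FreqMomentum L M → Fin 2 → ℂ} {Mth : ℕ → ℕ} {L₀ : ℕ} {B D : ℝ} {ρ : ℕ → ℝ}
    {Φ : ∀ (L M : ℕ) [NeZero L] [NeZero M], FreqMomentum L M → ℂ} {φ : ℤ → (Fin 2 → ℝ) → ℂ} {Bφ Kφ : ℝ} (hBφ : 0 ≤ Bφ) (hKφ : 0 ≤ Kφ)
    (hφb : ∀ (n : ℤ) (p : Fin 2 → ℝ), ‖φ n p‖ ≤ Bφ)
    (hφper : ∀ (n : ℤ) (p : Fin 2 → ℝ) (m : Fin 2 → ℤ), φ n (fun i => p i + m i * (2 * Real.pi)) = φ n p)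
    (hφlip : ∀ (n : ℤ) (p q : Fin 2 → ℝ), ‖φ n p - φ n q‖ ≤ Kφ * ‖p - q‖)
    (hΦ : ∀ (L M : ℕ) [NeZero L] [NeZero M] (ω : MatsubaraIdx M) (k : TorusSite 2 L),
      Φ L M (ω, k) = φ (matsubaraInt M ω) (latticeMomentum L k))
    (hbS : ∀ (L : ℕ) [NeZero L], L₀ ≤ L → ∀ (M : ℕ) [NeZero M], Mth L ≤ M → ∀ (k : FreqMomentum L M) (σ : Fin 2), ‖S L M k σ‖ ≤ B)
    (hS : ∀ (L : ℕ) [NeZero L], L₀ ≤ L → ∀ (M : ℕ) [NeZero M], Mth L ≤ M →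
      ∀ (L' : ℕ) [NeZero L'], L ≤ L' → ∀ (M' : ℕ) [NeZero M'], Mth L' ≤ M' →
        ∀ (σ : Fin 2) (ω : MatsubaraIdx M) (ω' : MatsubaraIdx M'), matsubaraInt M ω = matsubaraInt M' ω' →
          ∀ (k : TorusSite 2 L) (k' : TorusSite 2 L'),
            ‖S L M (ω, k) σ - S L' M' (ω', k') σ‖ ≤ ρ L + D * ∑ i, torusAbs (latticeMomentum L k i - latticeMomentum L' k' i)) :
    ∀ (L : ℕ) [NeZero L], L₀ ≤ L → ∀ (M : ℕ) [NeZero M], Mth L ≤ M →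
      ∀ (L' : ℕ) [NeZero L'], L ≤ L' → ∀ (M' : ℕ) [NeZero M'], Mth L' ≤ M' →
        ∀ (σ : Fin 2) (ω : MatsubaraIdx M) (ω' : MatsubaraIdx M'), matsubaraInt M ω = matsubaraInt M' ω' →
          ∀ (k : TorusSite 2 L) (k' : TorusSite 2 L'),
            ‖Φ L M (ω, k) * S L M (ω, k) σ - Φ L' M' (ω', k') * S L' M' (ω', k') σ‖ ≤
              (fun L => Bφ * ρ L) L + (Bφ * D + B * Kφ) * ∑ i, torusAbs (latticeMomentum L k i - latticeMomentum L' k' i) := by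
  intro L _ hL M _ hM L' _ hLL' M' _ hM' σ ω ω' hωω' k k'
  set x : ℝ := ∑ i, torusAbs (latticeMomentum L k i - latticeMomentum L' k' i) with hx
  have hx0 : 0 ≤ x := klvc_tmod_nonneg _ _
  have hL' : L₀ ≤ L' := hL.trans hLL'
  have h₁ := hS L hL M hM L' hLL' M' hM' σ ω ω' hωω' k k'
  have hB' := hbS L' hL' M' hM' (ω', k') σ
  have hB0 : 0 ≤ B := (norm_nonneg _).trans hB'
  have hΦΦ' : ‖Φ L M (ω, k) - Φ L' M' (ω', k')‖ ≤ Kφ * x := by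
    rw [hΦ, hΦ, ← hωω']
    exact norm_sub_le_mul_tmod_of_periodic (f := φ (matsubaraInt M ω)) hKφ (fun p m => hφper _ p m) (fun p q => hφlip _ p q) _ _
  have hΦb : ‖Φ L M (ω, k)‖ ≤ Bφ := by rw [hΦ]; exact hφb _ _
  calc ‖Φ L M (ω, k) * S L M (ω, k) σ - Φ L' M' (ω', k') * S L' M' (ω', k') σ‖
      = ‖Φ L M (ω, k) * (S L M (ω, k) σ - S L' M' (ω', k') σ) + (Φ L M (ω, k) - Φ L' M' (ω', k')) * S L' M' (ω', k') σ‖ := by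
        congr 1; ring
    _ ≤ ‖Φ L M (ω, k)‖ * ‖S L M (ω, k) σ - S L' M' (ω', k') σ‖ + ‖Φ L M (ω, k) - Φ L' M' (ω', k')‖ * ‖S L' M' (ω', k') σ‖ := by
        refine (norm_add_le _ _).trans ?_
        rw [norm_mul, norm_mul]
    _ ≤ Bφ * (ρ L + D * x) + (Kφ * x) * B := by
        gcongr
    _ = Bφ * ρ L + (Bφ * D + B * Kφ) * x := by ring

end Summit.HubbardSuperconductivity.HubbardSuperconductivity.Theorems.KLRegimeSplit
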